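import Summits.QuantumFields.BalabanUV.Beta.GAN24.WardPairingCoarse
import Summits.QuantumFields.BalabanUV.Beta.GAN24.RelInvWardPairingStep

/-!
# `BalabanUV.Beta.GAN24.WardPairingCoarseStep` — binder row G-an2-4 ∕ (CONV-C), W-slot CT-W, the (DL) question Q-g30-1: **«PAIR-COARSE» AT EVERY LEVEL —
# THE VALUE HESSIAN IS BLIND TO GAUGES, SO AT STEP `j + 1` THE SAME LAW HOLDS WITH THE FACTOR `stepScale_{j+1}`:
# `stepScale_{j+1}·Lc^{d+1}·codiff₁ (κ y ↦ (G_{j+1}∘W)(Lc•y) x (inr κ) b) y₀ = −blockSum Lc (codiff₁ (κ u ↦ W u x (inl κ) b)) y₀`**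
# (G-an2-4 formalisation swarm → CRUX TEAM (2), leaf prover `b2b-balaban-gan24-formalise-leaf-03`, gen 63, PART 2 of «PAIR-COARSE» (the OWNER gan24-p1 g30's
# W4 «WANTED»); module name PROVISIONAL — the row owner ∕ an2 ∕ road-P2 (author of `RelInvWardPairingStep`) may rename or re-home it)

NOT IN PRINT; OUR BOOKKEEPING ([folklore]: road-P2 g41's `RelInvWardPairingStep.ward_pairing_step` (leaf-06's Ward pairing with an2's straight step candidate
`bhKStep d Lc (j+1)`: field block `wVH_{j+1}·E2_{j+1}`, border `stepScale_{j+1}·𝒬ᵀ_{Lc}`) at the gauge of a BLOCK-CONSTANT potential, where the field block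
DROPS OUT because the value Hessian `wΦ` is co-closed in its second slot (an2 gen 15's `ValueHessianBlind.codiff₁_wΦ_right`, `lip0_codiff₁`); then PART 1
(`WardPairingCoarse`) §3 ∕ §5 verbatim; 0 `def`, 0 cited facts, 0 `def … : Prop`, 0 sorry).  HONEST FRAMING (cell contract, verbatim): «discharging `BetaPertH`
makes Bałaban's UV stability UNCONDITIONAL — a real constructive-QFT result; it is NOT the continuum limit and NOT the Clay problem.»  HONEST DEPENDENCY
(verbatim): «continuum YM on T⁴ ⇐ BetaPertH ∧ nine spine estimates (0/9 proved); BetaPertH ⇐ (D1) ∧ (D4) ∧ CAP+tail; G-an2-4 gates asym, D1 and NE2/3/4.»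

## Why
PART 1's law (`WardPairingCoarse.pow_mul_codiff₁_multiplierCol_eq`) is stated for the `j = 0` bordered Hessian `bhK` (field block `d*d`).  The top-level consumer of
the W-slot letter reads it through `KInvStep Lc n`, `n ≥ 1`, whose relative-inverse rule is road-P2's step version.  For a pure gauge `m = dz g` the step field block
`Σ'_v Σ_l wΦ κ l (u − v)·(dz g) l v` VANISHES for every BOUNDED `g` (summation by parts against the co-closed, summable row `l v ↦ wΦ κ l (u − v)`), so
`ward_pairing_step` collapses to `0 = ⟨dz g, W^F_{x,b}⟩ + stepScale_{j+1}·(multiplier word)` exactly as at `j = 0`, and PART 1 §5's argument goes through with the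
extra factor `stepScale_{j+1} = (Lc^{j+1})^{d+2}`.

## What (generic `d`; `Lc` the blocking, `[NeZero Lc]`)
* §0 (complement to PART 1 §5, no Ward pairing) **`tsum_dz_comp_blk_mul_eq`**: `Σ'_u Σ_κ dz (ψ ∘ blk Lc) κ u·w κ u = Σ'_y ψ y·blockSum Lc (codiff₁ w) y` — the bare TABLE
  reads a block-constant gauge insertion as (coarse potential) × (block TOTAL of the column's fine codifferential); `abs_tsum_dz_comp_blk_mul_le` its sup × mass bound.
* §1 `summable_wΦ_shift` ∕ **`tsum_sum_wΦ_mul_dz_eq_zero_of_bdd`** — the value-Hessian row is blind to the gauge of every BOUNDED potential: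
  `Σ'_v Σ_l wΦ κ l (u − v)·dz g l v = 0`.
* §2 **`ward_pairing_step_dz_blk`** — `RelInv G (bhKStep d Lc (j+1)) (axEc ρ Lc)`, `G`, `W` spread, `ψ` bounded coarse:
  `Σ'_u Σ_κ dz (ψ ∘ blk Lc) κ u·W u x (inl κ) b = −(stepScale_{j+1}·(Lc^{d+1}·Σ'_y ψ y·codiff₁ (κ y ↦ (G∘W)(Lc•y) x (inr κ) b) y))`.
* §3 THE LAW AT STEP `j + 1`: **`stepScale_mul_pow_mul_codiff₁_multiplierCol_eq`** (displayed in the title), and its corollaries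
  **`multiplierWord_dz_eq_zero_of_coclosed_step`** (co-closed table column ⟹ the multiplier word of every pure gauge with bounded block sums vanishes) and
  **`stepScale_mul_pow_mul_abs_codiff₁_multiplierCol_le`** (the ℓ¹ count: `stepScale_{j+1}·Lc^{d+1}·|codiff₁ (mult. col.) y₀| ≤ Σ_{v∈box Lc} |codiff₁ (table col.) (Lc•y₀+v)|`).
* §4 THE INSTANCE **`stepScale_mul_pow_mul_codiff₁_multiplierCol_coDressKBmAt_KInvStep_succ`**: `G_{j+1} = coDressKBmAt (toSite r) Lc (KInvStep Lc (j+1))`, every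
  in-block root `r`, every `j`, every spread `W` (an2's `relInv_coDressKBmAt_KInvStep_succ_bhKStep` BY NAME) — with PART 1 §4 (`j = 0`) the law holds at EVERY level.
* §5 JUNCTION WITH (W-LH): `blockSum_codiff₁_idK_col` (the block sum of a delta column's codifferential = an2's `gaugeWt`, written out) ⟹ at `W := idK` the law reads
  **`pow_mul_codiff₁_multiplierCol_idK_eq`** (`j = 0`) ∕ **`stepScale_mul_pow_mul_codiff₁_multiplierCol_idK_eq`** (step `j+1`):
  `(border normalisation)·codiff₁ (κ y ↦ G (Lc•y) x (inr κ) (inl κ₀)) y₀ = −gaugeWt Lc y₀ κ₀ x` — the multiplier-ROW ∕ field-COLUMN companion of d1-leaf-07's `ℋ`-column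
  Ward law `KernelWardHColumnWall.colH_ward_KInvStep_all` (entries `G u (Lc•y) (inl κ′) (inr μ)`, constant `+(stepScale·Lc^{d+1})⁻¹`); the relative sign is the bordered
  Hessian's `[[·, −𝒬ᵀ],[𝒬, 0]]` convention (located remark — no relation between the two entry sets is asserted here).

LOCATED CAVEAT (honest): identities + Hölder only; NO size of `codiff₁ W^F` for an2's literal tables is asserted — that is Q-g30-1's count (the OWNER W4 (3)).  The factor
`stepScale_{j+1}` is the step Hessian's border normalisation, not a gain: in the END's `unitS` currency it is absorbed by the unit scalings (units first, RG second).
Decides nothing about (Q-R) ∕ (DIV) ∕ (DL) ∕ K-LL-4′; NOTHING of (LT) ∕ (LAY) ∕ (S) ∕ «T2Shape» ∕ «T2Drift» ∕ (hW, hWall) discharged; 0 wall binders; NEVER «G-an2-4 closed»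
as (CONV-C); NOT D1, NOT `BetaPertH`, NOT continuum, NOT Clay; not in print — our bookkeeping.  Unit `b2b-balaban-gan24-formalise-leaf-03` (gen 63), 2026-08-22;
no existing file touched.
-/

noncomputable section

open Finset
open scoped BigOperators
open Literature.MathematicalPhysics.QuantumFieldTheory
open Literature.MathematicalPhysics.QuantumFieldTheory.Balaban1983to89
open Literature.MathematicalPhysics.QuantumFieldTheory.Balaban1983to89.Beta
open B12Sec2to5 (l1 l1_nonneg)
open ExpKernelCalculus (Site MKer Decays comp)
open AffineAveraging (Form0 Form1 box toSite unitVec dz codiff₁ blockSum contourSum)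
open AveragingContours (blk blk_block)
open KKTFluctuationEnergy (lip0 lip1 lip0_codiff₁ summable_mul_of_bdd tsum_blocks summable_blocks)
open KernelSpecInstance (wΦ)
open OneStepResolventKernel (Fib)
open HessKerSchurResolvent (idK idK_apply comp_idK_right)
open OneStepKernelFamily (KInvStep)
open BalabanStepJetsSucc (wVH)
open Summit.QuantumFields.BalabanUV.Beta.TameKernelCalculus
open Summit.QuantumFields.BalabanUV.Beta.ChartConjugationRelative (RelInv spr_comp)
open Summit.QuantumFields.BalabanUV.Beta.AxialDressingRooted (IsCombBondAt axEc coDressKBmAt spr_coDressKBmAt one_le_of_neZero)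
open Summit.QuantumFields.BalabanUV.Beta.BorderedHessian (stepScale stepScale_pos bhKStep spr_KInvStep relInv_coDressKBmAt_KInvStep_succ_bhKStep codiff₁_wΦ_right)
open Summit.QuantumFields.BalabanUV.Beta.GAN24.MultiplierZeroMass (summable_wΦ)
open Summit.QuantumFields.BalabanUV.Beta.GAN24.RelInvWardPairing (summable_bdd_mul)
open Summit.QuantumFields.BalabanUV.Beta.GAN24.RelInvWardPairingStep (ward_pairing_step)
open Summit.QuantumFields.BalabanUV.Beta.GAN24.WardPairingCoarse (summable_codiff₁ summable_abs_codiff₁ multiplierWord_dz_eq summable_abs_col_zsmul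
  dz_comp_blk_eq_zero_of_isCombBondAt abs_dz_comp_blk_le blockSum_comp_blk tsum_dz_blockInd_mul_eq_blockSum_codiff₁)

namespace Summit.QuantumFields.BalabanUV.Beta.GAN24.WardPairingCoarseStep

variable {d : ℕ} {Lc : ℕ} [NeZero Lc]

/-! ## §0 Complement to PART 1 §5 — the bare table's read of a block-constant gauge insertion, by parts (no Ward pairing) -/

/-- NOT IN PRINT; OUR BOOKKEEPING (`lip0_codiff₁` ⨾ block regrouping `tsum_blocks`).  **THE TABLE WORD OF A BLOCK-CONSTANT GAUGE INSERTION, BY PARTS**: for a bounded coarse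
potential `ψ` and a fine 1-form `w` with summable components, `Σ'_u Σ_κ dz (ψ ∘ blk Lc) κ u·w κ u = Σ'_y ψ y·blockSum Lc (codiff₁ w) y` — the bare table reads the insertion as
(coarse potential) × (BLOCK TOTAL of the column's fine codifferential); PART 1 §5's `tsum_dz_blockInd_mul_eq_blockSum_codiff₁` is the case `ψ = 𝟙_{y₀}`. -/
theorem tsum_dz_comp_blk_mul_eq {ψ : Form0 (d + 1) ℝ} {B : ℝ} (hψ : ∀ y, |ψ y| ≤ B) {w : Form1 (d + 1) ℝ} (hw : ∀ κ, Summable (w κ)) :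
    ∑' u, ∑ κ, dz (fun v => ψ (blk Lc v)) κ u * w κ u = ∑' y, ψ y * blockSum Lc (codiff₁ w) y := by
  have h := lip0_codiff₁ (f := fun v => ψ (blk Lc v)) (B := w) (fun v => hψ _) hw
  unfold KKTFluctuationEnergy.lip0 KKTFluctuationEnergy.lip1 at h
  rw [← h]
  have hs : Summable fun u => ψ (blk Lc u) * codiff₁ w u := summable_mul_of_bdd (fun u => hψ _) (summable_codiff₁ hw)
  rw [tsum_blocks (N := Lc) hs]
  refine tsum_congr fun y => ?_
  simp only [AffineAveraging.blockSum, Finset.mul_sum]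
  refine Finset.sum_congr rfl fun b hb => ?_
  rw [blk_block y hb]

/-- NOT IN PRINT; OUR BOOKKEEPING.  **SUP × MASS FOR THE TABLE WORD**: `|Σ'_u Σ_κ dz (ψ ∘ blk Lc) κ u·w κ u| ≤ B·Σ'_y |blockSum Lc (codiff₁ w) y|` (`|ψ| ≤ B`, components of `w`
absolutely summable). -/
theorem abs_tsum_dz_comp_blk_mul_le {ψ : Form0 (d + 1) ℝ} {B : ℝ} (hψ : ∀ y, |ψ y| ≤ B) {w : Form1 (d + 1) ℝ} (hw : ∀ κ, Summable fun u => |w κ u|) :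
    |∑' u, ∑ κ, dz (fun v => ψ (blk Lc v)) κ u * w κ u| ≤ B * ∑' y, |blockSum Lc (codiff₁ w) y| := by
  rw [tsum_dz_comp_blk_mul_eq hψ (fun κ => (hw κ).of_abs)]
  have hs0 : Summable fun u => |codiff₁ w u| := summable_abs_codiff₁ hw
  have hs : Summable fun y => |blockSum Lc (codiff₁ w) y| := by
    have hm := summable_blocks (N := Lc) hs0
    refine Summable.of_nonneg_of_le (fun y => abs_nonneg _) (fun y => ?_) hm
    exact Finset.abs_sum_le_sum_abs _ _
  have hb := tsum_of_norm_bounded (hs.mul_left B).hasSum (f := fun y => ψ y * blockSum Lc (codiff₁ w) y) (fun y => by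
    rw [Real.norm_eq_abs, abs_mul]
    exact mul_le_mul_of_nonneg_right (hψ y) (abs_nonneg _))
  rw [Real.norm_eq_abs, tsum_mul_left] at hb
  exact hb

/-! ## §1 The value Hessian is blind to the gauge of a bounded potential -/

/-- [folklore] The reflected value-Hessian row `v ↦ wΦ κ l (u − v)` is summable (`MultiplierZeroMass.summable_wΦ`, reflected). -/
theorem summable_wΦ_shift (M : ℕ) [NeZero M] (κ l : Fin (d + 1)) (u : Fin (d + 1) → ℤ) :
    Summable fun v : Fin (d + 1) → ℤ => wΦ (N := M) κ l (u - v) := by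
  have h := (Equiv.subLeft u).summable_iff.2 (summable_wΦ (N := M) (d := d) κ l)
  refine h.congr fun v => ?_
  simp [Equiv.subLeft]

/-- NOT IN PRINT; OUR BOOKKEEPING (`lip0_codiff₁` against the co-closed summable row `codiff₁_wΦ_right`).  **THE VALUE HESSIAN IS BLIND TO THE GAUGE OF EVERY BOUNDED
POTENTIAL**: `Σ'_v Σ_l wΦ κ l (u − v)·dz g l v = 0` (`|g| ≤ B`; an2 gen 15's `tsum_mul_dz_eq_zero_of_codiff₁` is the summable-`g` twin). -/
theorem tsum_sum_wΦ_mul_dz_eq_zero_of_bdd (M : ℕ) [NeZero M] {g : Form0 (d + 1) ℝ} {B : ℝ} (hg : ∀ v, |g v| ≤ B) (κ : Fin (d + 1))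
    (u : Fin (d + 1) → ℤ) :
    ∑' v, ∑ l : Fin (d + 1), wΦ (N := M) κ l (u - v) * dz g l v = 0 := by
  have h := lip0_codiff₁ (f := g) (B := fun l v => wΦ (N := M) κ l (u - v)) hg (fun l => summable_wΦ_shift M κ l u)
  rw [codiff₁_wΦ_right] at h
  unfold KKTFluctuationEnergy.lip0 KKTFluctuationEnergy.lip1 at h
  simp only [Pi.zero_apply, mul_zero, tsum_zero] at h
  rw [show (∑' v, ∑ l : Fin (d + 1), wΦ (N := M) κ l (u - v) * dz g l v) = ∑' v, ∑ l : Fin (d + 1), dz g l v * wΦ (N := M) κ l (u - v) from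
    tsum_congr fun v => Finset.sum_congr rfl fun l _ => mul_comm _ _]
  exact h.symm

/-! ## §2 The step Ward pairing of a block-constant gauge insertion -/

/-- NOT IN PRINT; OUR BOOKKEEPING (`ward_pairing_step` at `m := dz (ψ ∘ blk Lc)` ⨾ §1 ⨾ PART 1 §3).  **THE STEP WARD PAIRING OF A BLOCK-CONSTANT GAUGE INSERTION, CLOSED FORM**:
`RelInv G (bhKStep d Lc (j+1)) (axEc ρ Lc)`, `G`, `W` spread, `ψ` a bounded coarse potential ⟹ for every `(x, b)`
`Σ'_u Σ_κ dz (ψ ∘ blk Lc) κ u·W u x (inl κ) b = −(stepScale_{j+1}·(Lc^{d+1}·Σ'_y ψ y·codiff₁ (κ y ↦ (G∘W)(Lc•y) x (inr κ) b) y))`. -/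
theorem ward_pairing_step_dz_blk {ρ : Fin (d + 1) → ℤ} (j : ℕ) {G W : MKer (d + 1) (Fib d)}
    (hG : RelInv G (bhKStep d Lc (j + 1)) (axEc ρ Lc)) (hGs : Spr G) (hWs : Spr W) {ψ : Form0 (d + 1) ℝ} {B : ℝ} (hψ : ∀ y, |ψ y| ≤ B)
    (x : Fin (d + 1) → ℤ) (b : Fib d) :
    ∑' u, ∑ κ, dz (fun v => ψ (blk Lc v)) κ u * W u x (Sum.inl κ) b
      = -(stepScale d Lc (j + 1) * (((Lc : ℝ) ^ (d + 1)) * ∑' y, ψ y * codiff₁ (fun κ y => comp G W ((Lc : ℤ) • y) x (Sum.inr κ) b) y)) := by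
  have hLc : 1 ≤ Lc := one_le_of_neZero Lc
  obtain ⟨C, δ, hδ, hVd⟩ := spr_comp hGs hWs
  have hgB : ∀ v : Fin (d + 1) → ℤ, |(fun v => ψ (blk Lc v)) v| ≤ B := fun v => hψ _
  have h := ward_pairing_step j hG hGs hWs (m := dz (fun v => ψ (blk Lc v))) (abs_dz_comp_blk_le hψ)
    (fun κ u hc => dz_comp_blk_eq_zero_of_isCombBondAt ψ hc) x b
  have h0 : ∑' u, ∑ κ, (wVH d Lc (j + 1) * ∑' v, ∑ l : Fin (d + 1), wΦ (N := Lc ^ (j + 1)) κ l (u - v) * dz (fun v => ψ (blk Lc v)) l v)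
      * comp G W u x (Sum.inl κ) b = 0 := by
    simp [tsum_sum_wΦ_mul_dz_eq_zero_of_bdd (Lc ^ (j + 1)) hgB]
  rw [h0] at h
  have hφ : ∀ y, |blockSum Lc (fun v => ψ (blk Lc v)) y| ≤ ((Lc : ℝ) ^ (d + 1)) * B := fun y => by
    rw [blockSum_comp_blk, abs_mul, abs_of_nonneg (by positivity)]
    exact mul_le_mul_of_nonneg_left (hψ y) (by positivity)
  rw [multiplierWord_dz_eq hVd hδ hLc hφ x b] at h
  simp only [blockSum_comp_blk, mul_assoc] at h
  rw [tsum_mul_left] at h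
  linarith

/-! ## §3 The law at step `j + 1` -/

/-- NOT IN PRINT; OUR BOOKKEEPING (§2 at the indicator potential `ψ := 𝟙_{y₀}` ⨾ PART 1's `tsum_dz_blockInd_mul_eq_blockSum_codiff₁`).  **THE LAW AT STEP `j + 1`**:
`RelInv G (bhKStep d Lc (j+1)) (axEc ρ Lc)`, `G`, `W` spread ⟹ for every block `y₀` and column `(x, b)`
`stepScale_{j+1}·Lc^{d+1}·codiff₁ (κ y ↦ (G∘W)(Lc•y) x (inr κ) b) y₀ = −blockSum Lc (codiff₁ (κ u ↦ W u x (inl κ) b)) y₀` — the coarse codifferential of the step relative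
inverse's multiplier column is (minus, up to the border normalisation) the BLOCK MEAN of the table column's fine codifferential. -/
theorem stepScale_mul_pow_mul_codiff₁_multiplierCol_eq {ρ : Fin (d + 1) → ℤ} (j : ℕ) {G W : MKer (d + 1) (Fib d)}
    (hG : RelInv G (bhKStep d Lc (j + 1)) (axEc ρ Lc)) (hGs : Spr G) (hWs : Spr W) (y₀ x : Fin (d + 1) → ℤ) (b : Fib d) :
    stepScale d Lc (j + 1) * (((Lc : ℝ) ^ (d + 1)) * codiff₁ (fun κ y => comp G W ((Lc : ℤ) • y) x (Sum.inr κ) b) y₀)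
      = -blockSum Lc (codiff₁ (fun κ u => W u x (Sum.inl κ) b)) y₀ := by
  classical
  have hLc : 1 ≤ Lc := one_le_of_neZero Lc
  have hψ : ∀ y : Fin (d + 1) → ℤ, |(if y = y₀ then (1 : ℝ) else 0)| ≤ 1 := fun y => by split <;> simp
  have h := ward_pairing_step_dz_blk j hG hGs hWs hψ x b
  rw [tsum_dz_blockInd_mul_eq_blockSum_codiff₁ hLc y₀ (fun κ u => W u x (Sum.inl κ) b)] at h
  rw [tsum_eq_single y₀ (fun y hy => by rw [if_neg hy, zero_mul]), if_pos rfl, one_mul] at h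
  linarith

/-- NOT IN PRINT; OUR BOOKKEEPING.  **COROLLARY — CO-CLOSED TABLE COLUMN ⟹ THE STEP MULTIPLIER WORD OF EVERY PURE GAUGE VANISHES**: if `codiff₁ (κ u ↦ W u x (inl κ) b) = 0`
then for every potential `φ` with bounded `Lc`-block sums `Σ'_y Σ_κ contourSum Lc (dz φ) κ y·(G∘W)(Lc•y) x (inr κ) b = 0`. -/
theorem multiplierWord_dz_eq_zero_of_coclosed_step {ρ : Fin (d + 1) → ℤ} (j : ℕ) {G W : MKer (d + 1) (Fib d)}
    (hG : RelInv G (bhKStep d Lc (j + 1)) (axEc ρ Lc)) (hGs : Spr G) (hWs : Spr W) {x : Fin (d + 1) → ℤ} {b : Fib d}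
    (hco : codiff₁ (fun κ u => W u x (Sum.inl κ) b) = 0) {φ : Form0 (d + 1) ℝ} {B : ℝ} (hφ : ∀ y, |blockSum Lc φ y| ≤ B) :
    ∑' y, ∑ κ, contourSum Lc (dz φ) κ y * comp G W ((Lc : ℤ) • y) x (Sum.inr κ) b = 0 := by
  have hLc : 1 ≤ Lc := one_le_of_neZero Lc
  obtain ⟨C, δ, hδ, hVd⟩ := spr_comp hGs hWs
  have hcd : ∀ y, codiff₁ (fun κ y => comp G W ((Lc : ℤ) • y) x (Sum.inr κ) b) y = 0 := by
    intro y
    have h := stepScale_mul_pow_mul_codiff₁_multiplierCol_eq j hG hGs hWs y x b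
    rw [hco] at h
    simp only [AffineAveraging.blockSum, Pi.zero_apply, Finset.sum_const_zero, neg_zero, mul_eq_zero] at h
    rcases h with h | h | h
    · exact absurd h (ne_of_gt (stepScale_pos (d := d) (Lc := Lc) (j + 1)))
    · exact absurd (pow_eq_zero_iff (Nat.succ_ne_zero d) |>.1 h) (by exact_mod_cast Nat.one_le_iff_ne_zero.1 hLc)
    · exact h
  rw [multiplierWord_dz_eq hVd hδ hLc hφ x b]
  have hz : (fun y => blockSum Lc φ y * codiff₁ (fun κ y => comp G W ((Lc : ℤ) • y) x (Sum.inr κ) b) y) = fun _ => 0 := by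
    funext y; rw [hcd y, mul_zero]
  rw [hz, tsum_zero]

/-- NOT IN PRINT; OUR BOOKKEEPING.  **COROLLARY — THE COUNT IN ℓ¹ AT STEP `j + 1`**:
`stepScale_{j+1}·Lc^{d+1}·|codiff₁ (multiplier column) y₀| ≤ Σ_{v ∈ box Lc} |codiff₁ (table column) (Lc•y₀ + v)|`. -/
theorem stepScale_mul_pow_mul_abs_codiff₁_multiplierCol_le {ρ : Fin (d + 1) → ℤ} (j : ℕ) {G W : MKer (d + 1) (Fib d)}
    (hG : RelInv G (bhKStep d Lc (j + 1)) (axEc ρ Lc)) (hGs : Spr G) (hWs : Spr W) (y₀ x : Fin (d + 1) → ℤ) (b : Fib d) :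
    stepScale d Lc (j + 1) * (((Lc : ℝ) ^ (d + 1)) * |codiff₁ (fun κ y => comp G W ((Lc : ℤ) • y) x (Sum.inr κ) b) y₀|)
      ≤ ∑ v ∈ box (d + 1) Lc, |codiff₁ (fun κ u => W u x (Sum.inl κ) b) ((Lc : ℤ) • y₀ + toSite v)| := by
  have h := stepScale_mul_pow_mul_codiff₁_multiplierCol_eq j hG hGs hWs y₀ x b
  have hs : 0 ≤ stepScale d Lc (j + 1) := (stepScale_pos (d := d) (Lc := Lc) (j + 1)).le
  have e : stepScale d Lc (j + 1) * (((Lc : ℝ) ^ (d + 1)) * |codiff₁ (fun κ y => comp G W ((Lc : ℤ) • y) x (Sum.inr κ) b) y₀|)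
      = |stepScale d Lc (j + 1) * (((Lc : ℝ) ^ (d + 1)) * codiff₁ (fun κ y => comp G W ((Lc : ℤ) • y) x (Sum.inr κ) b) y₀)| := by
    rw [abs_mul, abs_mul, abs_of_nonneg hs, abs_of_nonneg (by positivity : (0 : ℝ) ≤ (Lc : ℝ) ^ (d + 1))]
  rw [e, h, abs_neg]
  exact Finset.abs_sum_le_sum_abs _ _

/-! ## §4 The instance `G_{j+1} = coDressKBmAt (toSite r) Lc (KInvStep Lc (j+1))` -/

/-- NOT IN PRINT; OUR BOOKKEEPING (an2's `relInv_coDressKBmAt_KInvStep_succ_bhKStep` + `spr_coDressKBmAt` BY NAME).  **THE LAW FOR THE CO-DRESSED STEP RESOLVENT AT EVERY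
LEVEL `j + 1`**: every in-block root `r`, every `j`, every spread `W`, every block `y₀` and column `(x, b)`. -/
theorem stepScale_mul_pow_mul_codiff₁_multiplierCol_coDressKBmAt_KInvStep_succ {r : Fin (d + 1) → ℕ} (hr : r ∈ box (d + 1) Lc) (j : ℕ)
    {W : MKer (d + 1) (Fib d)} (hWs : Spr W) (y₀ x : Fin (d + 1) → ℤ) (b : Fib d) :
    stepScale d Lc (j + 1) * (((Lc : ℝ) ^ (d + 1)) *
        codiff₁ (fun κ y => comp (coDressKBmAt (toSite r) Lc (KInvStep (d := d) Lc (j + 1))) W ((Lc : ℤ) • y) x (Sum.inr κ) b) y₀)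
      = -blockSum Lc (codiff₁ (fun κ u => W u x (Sum.inl κ) b)) y₀ :=
  stepScale_mul_pow_mul_codiff₁_multiplierCol_eq j (relInv_coDressKBmAt_KInvStep_succ_bhKStep hr j)
    (spr_coDressKBmAt (one_le_of_neZero Lc) hr (spr_KInvStep (j + 1))) hWs y₀ x b

/-! ## §5 Junction with the (W-LH) law: at `W = idK` the law is the MULTIPLIER-ROW companion of the `ℋ`-column Ward law -/

/-- [folklore] The block sum of the fine codifferential of a DELTA column is the pure-gauge weight of the block:
`blockSum N (codiff₁ (κ u ↦ idK u x (inl κ) (inl κ₀))) y₀ = 𝟙[blk N (x + e_κ₀) = y₀] − 𝟙[blk N x = y₀]` (= an2's `gaugeWt N y₀ κ₀ x`, letter for letter). -/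
theorem blockSum_codiff₁_idK_col {N : ℕ} (hN : 1 ≤ N) (y₀ x : Fin (d + 1) → ℤ) (κ₀ : Fin (d + 1)) :
    blockSum N (codiff₁ (fun κ u => (idK : MKer (d + 1) (Fib d)) u x (Sum.inl κ) (Sum.inl κ₀))) y₀
      = (if blk N (x + unitVec κ₀) = y₀ then (1 : ℝ) else 0) - (if blk N x = y₀ then (1 : ℝ) else 0) := by
  classical
  -- the delta column's codifferential: `[u = x + e_κ₀] − [u = x]`
  have hcd : ∀ u : Fin (d + 1) → ℤ, codiff₁ (fun κ u => (idK : MKer (d + 1) (Fib d)) u x (Sum.inl κ) (Sum.inl κ₀)) u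
      = (if u = x + unitVec κ₀ then (1 : ℝ) else 0) - (if u = x then (1 : ℝ) else 0) := by
    intro u
    simp only [AffineAveraging.codiff₁, idK_apply, Sum.inl.injEq, Finset.sum_sub_distrib]
    congr 1
    · rw [Finset.sum_eq_single κ₀ (fun κ _ hκ => by rw [if_neg (fun h => hκ h.2)]) (fun h => absurd (Finset.mem_univ κ₀) h)]
      by_cases hu : u = x + unitVec κ₀
      · rw [if_pos ⟨by rw [hu, add_sub_cancel_right], rfl⟩, if_pos hu]
      · rw [if_neg (fun h => hu (by rw [← h.1, sub_add_cancel])), if_neg hu]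
    · rw [Finset.sum_eq_single κ₀ (fun κ _ hκ => by rw [if_neg (fun h => hκ h.2)]) (fun h => absurd (Finset.mem_univ κ₀) h)]
      by_cases hu : u = x
      · rw [if_pos ⟨hu, rfl⟩, if_pos hu]
      · rw [if_neg (fun h => hu h.1), if_neg hu]
  -- the block sum of a point indicator is the block indicator of the point
  have hpt : ∀ z : Fin (d + 1) → ℤ, ∑ b ∈ box (d + 1) N, (if (N : ℤ) • y₀ + toSite b = z then (1 : ℝ) else 0) = if blk N z = y₀ then (1 : ℝ) else 0 := by
    intro z
    by_cases hz : blk N z = y₀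
    · rw [if_pos hz]
      have ez : (N : ℤ) • y₀ + toSite (AveragingContours.off N z) = z := by rw [← hz, AveragingContours.blk_add_off hN z]
      rw [Finset.sum_eq_single (AveragingContours.off N z) (fun b _ hb => ?_) (fun h => absurd (AveragingContours.off_mem_box hN z) h), if_pos ez]
      rw [if_neg]
      intro e
      exact hb (AxialProjector.toSite_injective (add_left_cancel (e.trans ez.symm)))
    · rw [if_neg hz]
      refine Finset.sum_eq_zero fun b hb => ?_
      rw [if_neg]
      intro e
      exact hz (by rw [← e, blk_block y₀ hb])
  simp only [AffineAveraging.blockSum, hcd, Finset.sum_sub_distrib, hpt]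

/-- NOT IN PRINT; OUR BOOKKEEPING (PART 1's law at `W := idK` ⨾ the previous lemma).  **JUNCTION WITH (W-LH), `j = 0`**: `RelInv G (bhK N) (axEc ρ N)`, `G` spread ⟹
`N^{d+1}·codiff₁ (κ y ↦ G (N•y) x (inr κ) (inl κ₀)) y₀ = −(𝟙[blk N (x + e_κ₀) = y₀] − 𝟙[blk N x = y₀])` — the MULTIPLIER-ROW ∕ field-column companion of d1-leaf-07's
`ℋ`-column law `KernelWardHColumnWall.colH_ward_KInvStep_all` (which reads `Σ_μ (colH G N μ (y − e_μ) κ′ u − colH G N μ y κ′ u) = (stepScale·N^{d+1})⁻¹·gaugeWt N y κ′ u` on the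
entries `G u (N•y) (inl κ′) (inr μ)`); the relative sign is the bordered Hessian's `[[·, −𝒬ᵀ],[𝒬, 0]]` convention (located remark; no relation between the two entry sets is claimed). -/
theorem pow_mul_codiff₁_multiplierCol_idK_eq {N : ℕ} [NeZero N] {ρ : Fin (d + 1) → ℤ} {G : MKer (d + 1) (Fib d)}
    (hG : RelInv G (Summit.QuantumFields.BalabanUV.Beta.BorderedHessian.bhK N) (axEc ρ N)) (hGs : Spr G) (y₀ x : Fin (d + 1) → ℤ) (κ₀ : Fin (d + 1)) :
    ((N : ℝ) ^ (d + 1)) * codiff₁ (fun κ y => G ((N : ℤ) • y) x (Sum.inr κ) (Sum.inl κ₀)) y₀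
      = -((if blk N (x + unitVec κ₀) = y₀ then (1 : ℝ) else 0) - (if blk N x = y₀ then (1 : ℝ) else 0)) := by
  classical
  have h := Summit.QuantumFields.BalabanUV.Beta.GAN24.WardPairingCoarse.pow_mul_codiff₁_multiplierCol_eq hG hGs spr_idK y₀ x (Sum.inl κ₀)
  simp only [comp_idK_right] at h
  rw [blockSum_codiff₁_idK_col (one_le_of_neZero N)] at h
  exact h

/-- NOT IN PRINT; OUR BOOKKEEPING (§3 at `W := idK`).  **JUNCTION WITH (W-LH), STEP `j + 1`**: `RelInv G (bhKStep d Lc (j+1)) (axEc ρ Lc)`, `G` spread ⟹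
`stepScale_{j+1}·Lc^{d+1}·codiff₁ (κ y ↦ G (Lc•y) x (inr κ) (inl κ₀)) y₀ = −(𝟙[blk Lc (x + e_κ₀) = y₀] − 𝟙[blk Lc x = y₀])`. -/
theorem stepScale_mul_pow_mul_codiff₁_multiplierCol_idK_eq {ρ : Fin (d + 1) → ℤ} (j : ℕ) {G : MKer (d + 1) (Fib d)}
    (hG : RelInv G (bhKStep d Lc (j + 1)) (axEc ρ Lc)) (hGs : Spr G) (y₀ x : Fin (d + 1) → ℤ) (κ₀ : Fin (d + 1)) :
    stepScale d Lc (j + 1) * (((Lc : ℝ) ^ (d + 1)) * codiff₁ (fun κ y => G ((Lc : ℤ) • y) x (Sum.inr κ) (Sum.inl κ₀)) y₀)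
      = -((if blk Lc (x + unitVec κ₀) = y₀ then (1 : ℝ) else 0) - (if blk Lc x = y₀ then (1 : ℝ) else 0)) := by
  classical
  have h := stepScale_mul_pow_mul_codiff₁_multiplierCol_eq j hG hGs spr_idK y₀ x (Sum.inl κ₀)
  simp only [comp_idK_right] at h
  rw [blockSum_codiff₁_idK_col (one_le_of_neZero Lc)] at h
  exact h

end Summit.QuantumFields.BalabanUV.Beta.GAN24.WardPairingCoarseStep

end
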